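import Summits.BirchSwinnertonDyer.BirchSwinnertonDyer.Theorems.CumulativeHeegnerLeopoldtCumulativeHeegnerInclusionAtThreeTraceZeroHeegnerModule
import HarnessLib

/-!
# Route `CumulativeHeegnerLeopoldt`, crux K1 `CumulativeHeegnerInclusionAtThree` (stmt-BirchSwinnertonDyer-24198),
# line `birth`, stub A (= crux stmt-26896): the trace-zero BARRIER LEMMA in TORSION-ROBUST form
# (sequel of `…CumulativeHeegnerInclusionAtThreeTraceZeroHeegnerModule`, p621811 / p622174)

Lead prover bsd-line-chl-k1-p1 g3, `--supports stmt-BirchSwinnertonDyer-24198`. THEOREMS ONLY (no definition, no named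
fact, no `sorry`). The printed distribution relation for the natural objects of an A-line — GOOD CM points of `3`-power
conductor on `X₀(N)` for an Eichler order of level `3^δ`, `δ = v₃(N) ≥ 2` — is Cornut–Vatsal, *Nontriviality of
Rankin–Selberg L-functions and CM points* (in: L-functions and Galois representations, LMS LNS 320, CUP 2007), §6.4
Lemma 6.14: «for any `x ∈ CM_H` which is not of type III, `Tr(x) = 0` in `ℤ[CM_H]^{P-new}`», whence (Lemma 4.9 (iii))
`d(x) = q · ιx` in `J^{P-new} ⊗ ℚ`: on the curve `E` (a `3`-new quotient) the trace `Tr_{K[3^n]/K[3^{n-1}]} x` of a good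
CM point is TORSION, not necessarily `0`. This file removes the gap between that printed form and the exact trace-zero
hypothesis `hTZ` of the predecessor file: when `E(K_∞)[p^∞] = 0` (landed on the Leopoldt cell, p615628), a torsion point
of a layer `E(K_ℓ)` has order prime to `p`, so its Kummer family vanishes, and the whole universal-norm argument runs with
«the Kummer family of the trace is `0`» in place of «the trace is `0`».

* §1 `kummerFamily_eq_zero_of_zsmul_eq_zero_of_not_dvd` (`m • t = 0`, `p ∤ m` ⟹ `δ(t) = 0`),
  `zsmul_eq_zero_of_pow_mul_zsmul_eq_zero_of_fixedPoints_eq_bot`, `kummerFamily_eq_zero_of_torsion_of_fixedPoints_eq_bot`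
  (torsion points of the layers have vanishing Kummer families when `E(K_∞)[p^∞] = 0`), `smul_trace_z_eq`.
* §2 `exists_sum_conjPi_eq_resPi_smul_of_mem_heegnerModuleLayer_of_kummerTraceZero` — one norm step
  `𝒩 ℋ̄_{k+1} ⊆ res(p·ℋ̄_k)` under «Kummer family of `Tr z_{k+1}` vanishes».
* §3 **`heegnerModule_eq_bot_of_traceTorsion_of_fixedPoints_eq_bot`**, **`heegnerModule_eq_bot_of_traceTorsion`**
  (`E(K)[p] = 0` form), **`heegnerModule_eq_bot_on_leopoldtCell_of_traceTorsion`**: `ℋ_∞(F) = ⊥` as soon as every trace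
  `Tr_{K_{j+1}/K_j} z_{j+1}` is torsion.
HONEST FRAMING: module bookkeeping over the tree's Howard/Perrin-Riou objects; the CM relation itself (Cornut–Vatsal
Lemma 6.14) is NOT typed here (hypothesis `hTT`); a barrier lemma for the ideation of A 26896, not a step toward BSD;
BSD is not proved by any of this.

References: [PerrinRiou1987BSMF] §3.4 Prop. 10; [Howard2004HeegnerKolyvagin] §3.3; [GreenbergLNM1716] §4 p. 109;
Cornut–Vatsal 2007 (LMS LNS 320) Def. 1.6, Lemma 4.9 (iii), §6.4 Lemma 6.14, Rem. 6.15 (held: corpus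
book:burns2007-l-functions-galois-representations, pp. 0160, 0191, 0216–0217).
-/

set_option autoImplicit false
set_option linter.dupNamespace false

noncomputable section

open scoped Classical

open WeierstrassCurve Literature.NumberTheory.EllipticCurves PowerSeries

universe u

namespace Summit.BirchSwinnertonDyer.BirchSwinnertonDyer.Theorems.CumulativeHeegnerInclusionAtThreeTraceZero

variable {K : Type u} [Field K] [NumberField K] {N : ℕ} [NeZero N] {W : WeierstrassCurve ℚ} [W.IsElliptic]
  {p : ℕ} [Fact p.Prime] {κ : ZpExtension K p} {γ : Field.absoluteGaloisGroup K}
  {jbar : AlgebraicClosure K →+* ℂ}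

/-! ## §1–§3 TORSION-ROBUST form: it suffices that the traces `Tr_{K_{j+1}/K_j} z_{j+1}` be TORSION
(Cornut–Vatsal 2007, Lemma 4.9 (iii) / Lemma 6.14: for an Eichler order of level `P^δ`, `δ ≥ 2` — here `9 ∣ N` — and a GOOD
CM point `x` of conductor `P^n`, `Tr x = 0` in the `P`-new quotient of `ℤ[CM]`, hence the trace is torsion in `A ⊗ ℚ`) -/

/-- **A Kummer family of a point killed by an integer prime to `p` vanishes**: if `m • t = 0` with `p ∤ m` and `d` is the
Kummer family of `t` over `L = K̄^H`, then `d = 0` (`m • d` is the Kummer family of `m • t = 0`, and `m` is invertible on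
the `p^k`-torsion level `H¹(H, E[p^k])`). [cite: SilvermanAEC2009, VIII.§2 (Kummer pairing, bilinearity)] -/
theorem kummerFamily_eq_zero_of_zsmul_eq_zero_of_not_dvd {H : Subgroup (Field.absoluteGaloisGroup K)}
    {t : geomPoints (W.baseChange K)} {hP : ∀ σ ∈ H, σ • t = t} {m : ℤ} (hm : ¬ (p : ℤ) ∣ m) (hmt : m • t = 0)
    {d : (W.baseChange K).torsionH1Pi p H} (hd : (W.baseChange K).IsKummerFamilyOver p H hP d) : d = 0 := by
  have hp : p.Prime := Fact.out
  have hmd : m • d = 0 :=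
    IsKummerFamilyOver.unique p (IsKummerFamilyOver.of_eq hmt (hd.zsmul m))
      (isKummerFamilyOver_zero (V := W.baseChange K) (H' := H) (p := p))
  funext k
  obtain ⟨a, b, hab⟩ : IsCoprime ((p : ℤ) ^ k) m :=
    IsCoprime.pow_left ((Prime.coprime_iff_not_dvd (Nat.prime_iff_prime_int.mp hp)).mpr hm)
  have hk : ((p : ℤ) ^ k) • d k = 0 := (W.baseChange K).pow_smul_torsionH1Over_eq_zero H p k (d k)
  have hmk : m • d k = 0 := by simpa only [Pi.smul_apply, Pi.zero_apply] using congrFun hmd k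
  calc d k = (a * (p : ℤ) ^ k + b * m) • d k := by rw [hab, one_zsmul]
    _ = 0 := by rw [add_zsmul, mul_zsmul, mul_zsmul, hk, hmk, zsmul_zero, zsmul_zero, add_zero]

omit [W.IsElliptic] in
/-- **A torsion point of a layer of the tower has order prime to `p` when `E(K_∞)[p^∞] = 0`**: if `t` is fixed by
`Gal(K̄/K_ℓ)`, `m • t = 0` with `m = p^e · m'`, `p ∤ m'`, then already `m' • t = 0` (`m' • t ∈ E(K_∞)[p^∞] = 0`).
[cite: GreenbergLNM1716, §4 p. 109 (E(F_∞)[p^∞] = 0)] -/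
theorem zsmul_eq_zero_of_pow_mul_zsmul_eq_zero_of_fixedPoints_eq_bot
    (hbot : FixedPoints.addSubgroup κ.kerSubgroup ((W.baseChange K).geomPrimaryTorsion p) = ⊥) {ℓ : ℕ}
    {t : geomPoints (W.baseChange K)} (ht : ∀ σ ∈ κ.layerSubgroup ℓ, σ • t = t) {e : ℕ} {m' : ℤ}
    (hmt : ((p : ℤ) ^ e * m') • t = 0) : m' • t = 0 := by
  have hmem : m' • t ∈ geomPrimaryTorsion (W.baseChange K) p := by
    refine (AddCommGroup.mem_primaryComponent).mpr ⟨e, ?_⟩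
    rw [← natCast_zsmul, Nat.cast_pow, ← mul_zsmul, hmt]
  have hfix : (⟨m' • t, hmem⟩ : geomPrimaryTorsion (W.baseChange K) p) ∈
      FixedPoints.addSubgroup κ.kerSubgroup (geomPrimaryTorsion (W.baseChange K) p) := by
    rw [FixedPoints.mem_addSubgroup]
    rintro ⟨τ, hτ⟩
    apply Subtype.ext
    rw [Subgroup.mk_smul, primaryComponent.coe_smul]
    change τ • (m' • t) = m' • t
    rw [smul_zsmul_geomPoints, ht τ (κ.kerSubgroup_le_layerSubgroup ℓ hτ)]
  rw [hbot, AddSubgroup.mem_bot] at hfix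
  exact congrArg Subtype.val hfix

/-- **Kummer families of torsion points of the layers vanish when `E(K_∞)[p^∞] = 0`.** If `t` is fixed by `Gal(K̄/K_ℓ)`,
`m • t = 0` for some integer `m ≠ 0`, and `d` is the Kummer family of `t` over `K_ℓ`, then `d = 0`.
[cite: GreenbergLNM1716, §4 p. 109] [cite: SilvermanAEC2009, VIII.§2] -/
theorem kummerFamily_eq_zero_of_torsion_of_fixedPoints_eq_bot
    (hbot : FixedPoints.addSubgroup κ.kerSubgroup ((W.baseChange K).geomPrimaryTorsion p) = ⊥) {ℓ : ℕ}
    {t : geomPoints (W.baseChange K)} {ht : ∀ σ ∈ κ.layerSubgroup ℓ, σ • t = t} {m : ℤ} (hm0 : m ≠ 0)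
    (hmt : m • t = 0) {d : (W.baseChange K).torsionH1Pi p (κ.layerSubgroup ℓ)}
    (hd : (W.baseChange K).IsKummerFamilyOver p (κ.layerSubgroup ℓ) ht d) : d = 0 := by
  have hp : p.Prime := Fact.out
  -- `|m| = p^e · n'` with `p ∤ n'`
  obtain ⟨e, n', hn', hmn⟩ := Nat.exists_eq_pow_mul_and_not_dvd (Int.natAbs_ne_zero.mpr hm0) p hp.ne_one
  have habs : ((m.natAbs : ℕ) : ℤ) • t = 0 := by
    rcases Int.natAbs_eq m with h | h
    · rw [← h, hmt]
    · rw [show ((m.natAbs : ℕ) : ℤ) = -m by omega, neg_zsmul, hmt, neg_zero]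
  rw [hmn, Nat.cast_mul, Nat.cast_pow] at habs
  have hn't : ((n' : ℕ) : ℤ) • t = 0 :=
    zsmul_eq_zero_of_pow_mul_zsmul_eq_zero_of_fixedPoints_eq_bot hbot ht habs
  have hnd : ¬ (p : ℤ) ∣ ((n' : ℕ) : ℤ) := fun h ↦ hn' (Int.natCast_dvd_natCast.mp h)
  exact kummerFamily_eq_zero_of_zsmul_eq_zero_of_not_dvd hnd hn't hd

omit [W.IsElliptic] in
/-- The trace `Σ_{i<p} γ^{p^k i} • z_{k+1}` of the norm point `z_{k+1}` is `K_{k+1}`-rational (indeed `K_k`-rational;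
only the weaker statement is needed to speak of its Kummer family over `K_{k+1}`). [cite: Howard2004HeegnerKolyvagin, §3.3] -/
theorem smul_trace_z_eq (F : HeegnerFamily N W K κ jbar) (k : ℕ) {τ : Field.absoluteGaloisGroup K}
    (hτ : τ ∈ κ.layerSubgroup (k + 1)) :
    τ • (∑ i ∈ Finset.range p, (γ ^ (p ^ k * i)) • F.z (k + 1)) = ∑ i ∈ Finset.range p, (γ ^ (p ^ k * i)) • F.z (k + 1) := by
  rw [Finset.smul_sum]
  refine Finset.sum_congr rfl fun i _ ↦ ?_
  rw [← mul_smul, show τ * γ ^ (p ^ k * i) = γ ^ (p ^ k * i) * ((γ ^ (p ^ k * i))⁻¹ * τ * γ ^ (p ^ k * i))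
    by group, mul_smul, (F.isHeegnerNormPoint_z (k + 1)).smul_eq_self
    (conj_mem_of_normal (κ.layerSubgroup (k + 1)) (γ ^ (p ^ k * i)) ⟨τ, hτ⟩)]

/-- **One norm step, Kummer-trace-zero form** (generalises §1): if every Kummer family over `K_{k+1}` of the trace
`Tr_{K_{k+1}/K_k} z_{k+1}` vanishes (e.g. the trace is `0`, §1; or torsion with `E(K_∞)[p^∞] = 0`, above), then for every
`x ∈ ℋ̄_{k+1}(F)` there is `y ∈ ℋ̄_k(F)` with `Σ_{i<p} conj_{γ^{p^k i}} x = res_{k→k+1} (p • y)`.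
[cite: PerrinRiou1987BSMF, §0 p. 402 and §3.4] [cite: Howard2004HeegnerKolyvagin, §3.3 (H_k)] -/
theorem exists_sum_conjPi_eq_resPi_smul_of_mem_heegnerModuleLayer_of_kummerTraceZero (hγ : κ.IsTopGenerator γ)
    (F : HeegnerFamily N W K κ jbar) (k : ℕ)
    (hTZK : ∀ dt : (W.baseChange K).torsionH1Pi p (κ.layerSubgroup (k + 1)),
      (W.baseChange K).IsKummerFamilyOver p (κ.layerSubgroup (k + 1))
        (P := ∑ i ∈ Finset.range p, (γ ^ (p ^ k * i)) • F.z (k + 1)) (fun _ hτ ↦ smul_trace_z_eq F k hτ) dt → dt = 0)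
    {x : (W.baseChange K).torsionH1Pi p (κ.layerSubgroup (k + 1))} (hx : x ∈ heegnerModuleLayer γ F (k + 1)) :
    ∃ y ∈ heegnerModuleLayer γ F k,
      ∑ i ∈ Finset.range p, (W.baseChange K).conjPi p (κ.layerSubgroup (k + 1)) (γ ^ (p ^ k * i)) x =
        (W.baseChange K).resPi p (κ.layerSubgroup_antitone (Nat.le_succ k)) ((p : ℤ) • y) := by
  have hle : κ.layerSubgroup (k + 1) ≤ κ.layerSubgroup k := κ.layerSubgroup_antitone (Nat.le_succ k)
  obtain ⟨𝒩, h𝒩ap⟩ : ∃ 𝒩 : (W.baseChange K).torsionH1Pi p (κ.layerSubgroup (k + 1)) →+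
      (W.baseChange K).torsionH1Pi p (κ.layerSubgroup (k + 1)),
      ∀ x, 𝒩 x = ∑ i ∈ Finset.range p, (W.baseChange K).conjPi p (κ.layerSubgroup (k + 1)) (γ ^ (p ^ k * i)) x :=
    ⟨∑ i ∈ Finset.range p, (W.baseChange K).conjPi p (κ.layerSubgroup (k + 1)) (γ ^ (p ^ k * i)),
      fun x ↦ by rw [AddMonoidHom.finsetSum_apply]⟩
  obtain ⟨res, hres⟩ : ∃ res : (W.baseChange K).torsionH1Pi p (κ.layerSubgroup k) →+
      (W.baseChange K).torsionH1Pi p (κ.layerSubgroup (k + 1)), ∀ y, res y = (W.baseChange K).resPi p hle y :=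
    ⟨_, fun _ ↦ rfl⟩
  suffices h : ∃ y ∈ heegnerModuleLayer γ F k, 𝒩 x = res ((p : ℤ) • y) by
    obtain ⟨y, hy, h⟩ := h
    exact ⟨y, hy, by rw [← h𝒩ap, h, hres]⟩
  refine AddSubgroup.closure_induction (p := fun x _ ↦ ∃ y ∈ heegnerModuleLayer γ F k, 𝒩 x = res ((p : ℤ) • y))
    ?_ ?_ ?_ ?_ hx
  · rintro _ ⟨c, i, w, hw, d, hd, rfl⟩
    have hd' : (W.baseChange K).IsKummerFamilyOver p (κ.layerSubgroup (k + 1))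
        (fun σ hσ ↦ F.smul_eq_of_mem_generators hw hσ) d := fun m Q hQ ↦ hd m Q hQ
    suffices hdN : ∃ y ∈ heegnerModuleLayer γ F k, 𝒩 d = res ((p : ℤ) • y) by
      obtain ⟨y, hy, hyd⟩ := hdN
      refine ⟨(W.baseChange K).padicPi p (κ.layerSubgroup k) c
        ((W.baseChange K).conjPi p (κ.layerSubgroup k) (γ ^ i) y), ?_, ?_⟩
      · revert hy
        refine fun hy ↦ AddSubgroup.closure_induction
          (p := fun y _ ↦ (W.baseChange K).padicPi p (κ.layerSubgroup k) c
            ((W.baseChange K).conjPi p (κ.layerSubgroup k) (γ ^ i) y) ∈ heegnerModuleLayer γ F k) ?_ ?_ ?_ ?_ hy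
        · rintro _ ⟨c', i', w', hw', d', hd'', rfl⟩
          refine AddSubgroup.subset_closure ⟨c * c', i + i', w', hw', d', hd'', ?_⟩
          rw [conjPi_padicPi_comm, padicPi_padicPi, ← conjPi_mul, ← pow_add]
        · rw [map_zero, map_zero]; exact AddSubgroup.zero_mem _
        · intro a b _ _ ha hb
          rw [map_add, map_add]; exact AddSubgroup.add_mem _ ha hb
        · intro a _ ha
          rw [map_neg, map_neg]; exact AddSubgroup.neg_mem _ ha
      · rw [h𝒩ap, sum_conjPi_padicPi, sum_conjPi_pow_conjPi_pow, ← h𝒩ap, hyd, hres, hres, ← resPi_conjPi,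
          ← resPi_padicPi, map_zsmul, map_zsmul]
    have hrat : ∀ (hwk : w ∈ F.generators k), ∃ y ∈ heegnerModuleLayer γ F k, 𝒩 d = res ((p : ℤ) • y) := by
      intro hwk
      have hwfix : ∀ σ ∈ κ.layerSubgroup k, σ • w = w := fun σ hσ ↦ F.smul_eq_of_mem_generators hwk hσ
      obtain ⟨dk, hdk⟩ := exists_isKummerFamilyOver (W.baseChange K) p (κ.layerSubgroup k) _ hwfix
      refine ⟨dk, mem_heegnerModuleLayer_of_isKummerFamilyOver_generator F γ k hwk hdk, ?_⟩
      have hN := (W.baseChange K).sum_conjPi_eq_pow_smul_of_isKummerFamilyOver p κ hγ (n := 1) hle hwfix hd'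
      rw [pow_one, pow_one] at hN
      rw [h𝒩ap, hN, (W.baseChange K).eq_resPi_of_isKummerFamilyOver p κ hle hwfix hdk hd', hres, map_zsmul]
    rcases hw with hw | ⟨j, hj, hjw⟩
    · exact hrat (Set.mem_union_left _ hw)
    · rcases Nat.lt_or_ge j (k + 1) with hjk | hjk
      · exact hrat (Set.mem_union_right _ ⟨j, Set.mem_setOf.mpr (Nat.lt_succ_iff.mp hjk), hjw⟩)
      · have hjeq : j = k + 1 := le_antisymm hj hjk
        subst hjeq
        subst hjw
        refine ⟨0, AddSubgroup.zero_mem _, ?_⟩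
        have hsum := IsKummerFamilyOver.sum (p := p) (Finset.range p)
          (P := fun i ↦ (γ ^ (p ^ k * i)) • F.z (k + 1))
          (d := fun i ↦ (W.baseChange K).conjPi p (κ.layerSubgroup (k + 1)) (γ ^ (p ^ k * i)) d)
          (hP := fun i τ hτ ↦ by
            rw [← mul_smul, show τ * γ ^ (p ^ k * i) = γ ^ (p ^ k * i) * ((γ ^ (p ^ k * i))⁻¹ * τ * γ ^ (p ^ k * i))
              by group, mul_smul, (F.isHeegnerNormPoint_z (k + 1)).smul_eq_self
              (conj_mem_of_normal (κ.layerSubgroup (k + 1)) (γ ^ (p ^ k * i)) ⟨τ, hτ⟩)])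
          (fun i ↦ hd'.conjPi (γ ^ (p ^ k * i)))
        rw [h𝒩ap, hTZK _ hsum, zsmul_zero, map_zero]
  · exact ⟨0, AddSubgroup.zero_mem _, by rw [map_zero, zsmul_zero, map_zero]⟩
  · rintro a b _ _ ⟨ya, hya, ha⟩ ⟨yb, hyb, hb⟩
    exact ⟨ya + yb, AddSubgroup.add_mem _ hya hyb, by rw [map_add, ha, hb, zsmul_add, map_add]⟩
  · rintro a _ ⟨ya, hya, ha⟩
    exact ⟨-ya, AddSubgroup.neg_mem _ hya, by rw [map_neg, ha, zsmul_neg, map_neg]⟩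

/-- **BARRIER LEMMA, torsion-robust form.** If `E(K_∞)[p^∞] = 0` and every trace `Tr_{K_{j+1}/K_j} z_{j+1}` is TORSION
(`m_j • Tr z_{j+1} = 0`, `m_j ≠ 0` — the printed form of the trace relation for good CM points at `p² ∣ N`:
Cornut–Vatsal 2007, Lemma 4.9 (iii), «`d(x) = q · ιx` in `J^{P-new} ⊗ ℚ`»), then `ℋ_∞(F) = ⊥` for every `Λ`-adic Selmer
datum `D`. [cite: PerrinRiou1987BSMF, §3.4 Prop. 10] [cite: Howard2004HeegnerKolyvagin, §3.3 (𝐇 = lim← H_k)] -/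
theorem heegnerModule_eq_bot_of_traceTorsion_of_fixedPoints_eq_bot (hγ : κ.IsTopGenerator γ)
    (hbot : FixedPoints.addSubgroup κ.kerSubgroup ((W.baseChange K).geomPrimaryTorsion p) = ⊥)
    (D : (W.baseChange K).LambdaAdicSelmerData κ γ) (F : HeegnerFamily N W K κ jbar)
    (hTT : ∀ j, ∃ m : ℤ, m ≠ 0 ∧ m • (∑ i ∈ Finset.range p, (γ ^ (p ^ j * i)) • F.z (j + 1)) = 0) :
    heegnerModule D F = ⊥ := by
  -- Kummer-trace-zero at every layer
  have hTZK : ∀ (k : ℕ) (dt : (W.baseChange K).torsionH1Pi p (κ.layerSubgroup (k + 1))),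
      (W.baseChange K).IsKummerFamilyOver p (κ.layerSubgroup (k + 1))
        (P := ∑ i ∈ Finset.range p, (γ ^ (p ^ k * i)) • F.z (k + 1)) (fun _ hτ ↦ smul_trace_z_eq F k hτ) dt →
        dt = 0 := by
    intro k dt hdt
    obtain ⟨m, hm0, hmt⟩ := hTT k
    exact kummerFamily_eq_zero_of_torsion_of_fixedPoints_eq_bot hbot hm0 hmt hdt
  -- `proj_k s ∈ p^m ℋ̄_k` for all `m`, as in §3
  have hdiv : ∀ {s : D.S}, (∀ ℓ, D.proj ℓ s ∈ heegnerModuleLayer γ F ℓ) →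
      ∀ m k : ℕ, ∃ y ∈ heegnerModuleLayer γ F k, D.proj k s = ((p : ℤ) ^ m) • y := by
    intro s hs m
    induction m with
    | zero => exact fun k ↦ ⟨D.proj k s, hs k, by rw [pow_zero, one_zsmul]⟩
    | succ m ih =>
      intro k
      obtain ⟨y', hy', hy'eq⟩ := ih (k + 1)
      obtain ⟨y, hy, hyeq⟩ :=
        exists_sum_conjPi_eq_resPi_smul_of_mem_heegnerModuleLayer_of_kummerTraceZero hγ F k (hTZK k) hy'
      refine ⟨y, hy, ?_⟩
      have hle : κ.layerSubgroup (k + 1) ≤ κ.layerSubgroup k := κ.layerSubgroup_antitone (Nat.le_succ k)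
      have hnorm := D.proj_norm k s
      rw [hy'eq, (W.baseChange K).sum_conjPi_zsmul p (κ.layerSubgroup (k + 1)) (Finset.range p)
        (fun i ↦ γ ^ (p ^ k * i)) (((p : ℤ)) ^ m) y', hyeq, ← map_zsmul, ← mul_zsmul, ← pow_succ] at hnorm
      exact resPi_layer_injective_of_fixedPoints_eq_bot hbot hle hnorm
  rw [heegnerModule, Submodule.span_eq_bot]
  intro s hs
  refine D.ext s fun k ↦ ?_
  funext m
  obtain ⟨y, -, hy⟩ := hdiv hs m k
  calc D.proj k s m = (((p : ℤ) ^ m) • y) m := by rw [hy]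
    _ = ((p : ℤ) ^ m) • y m := rfl
    _ = 0 := (W.baseChange K).pow_smul_torsionH1Over_eq_zero (κ.layerSubgroup k) p m (y m)

/-- **BARRIER LEMMA, torsion-robust form, `E(K)[p] = 0` version.** [cite: PerrinRiou1987BSMF, §3.4 Prop. 10]
[cite: GreenbergLNM1716, §4 p. 109] -/
theorem heegnerModule_eq_bot_of_traceTorsion (hγ : κ.IsTopGenerator γ)
    (hE : ∀ P : (W.baseChange K).toAffine.Point, p • P = 0 → P = 0)
    (D : (W.baseChange K).LambdaAdicSelmerData κ γ) (F : HeegnerFamily N W K κ jbar)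
    (hTT : ∀ j, ∃ m : ℤ, m ≠ 0 ∧ m • (∑ i ∈ Finset.range p, (γ ^ (p ^ j * i)) • F.z (j + 1)) = 0) :
    heegnerModule D F = ⊥ :=
  heegnerModule_eq_bot_of_traceTorsion_of_fixedPoints_eq_bot hγ
    ((W.baseChange K).fixedPoints_kerSubgroup_geomPrimaryTorsion_eq_bot κ hE) D F hTT

section LeopoldtCellTorsion

variable {K₀ : Type} [Field K₀] [NumberField K₀] {W₀ : WeierstrassCurve ℚ} [W₀.IsElliptic] [W₀.IsGloballyMinimal]
  {N₀ : ℕ} [NeZero N₀] {κ₃ : ZpExtension K₀ 3} {γ₃ : Field.absoluteGaloisGroup K₀} {jbar₀ : AlgebraicClosure K₀ →+* ℂ}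

/-- **BARRIER LEMMA ON THE LEOPOLDT CELL, torsion-robust form**: on the cell of crux K1 / A (wild additive `3`,
non-anomalous rational line, `K` Heegner for `N = N_E`), for every `ℤ₃`-extension `κ` with topological generator `γ`,
every `Λ`-adic Selmer datum `D` and every Heegner family `F` at level `N` whose traces `Tr_{K_{j+1}/K_j} z_{j+1}` are
TORSION (Cornut–Vatsal 2007, Lemma 4.9 (iii) for good CM points, `9 ∣ N`), `ℋ_∞(F) = ⊥`; the torsion input
`E(K_∞)[3^∞] = 0` is `…CellNoThreeTorsion.cell_fixedPoints_kerSubgroup_eq_bot` (p615628).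
[cite: PerrinRiou1987BSMF, §3.4 Prop. 10] [cite: Castella2018Erratum, Lemma 2.1] -/
theorem heegnerModule_eq_bot_on_leopoldtCell_of_traceTorsion
    (hO6 : Summit.BirchSwinnertonDyer.Rank1Residual.Additive.ClassO6 W₀ 3)
    (hline : ∃ Φ : AddSubgroup (WeierstrassCurve.geomTorsion W₀ ((3 : ℕ) : ℤ)),
        Literature.NumberTheory.EllipticCurves.Rank1Residual.IsRationalLine W₀ 3 Φ ∧
        ∀ (v : IsDedekindDomain.HeightOneSpectrum (NumberField.RingOfIntegers ℚ)),
          ((3 : ℕ) : NumberField.RingOfIntegers ℚ) ∈ v.asIdeal → ∀ 𝔓 ∈ v.primesAbove,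
          ¬ (∀ g ∈ 𝔓.decompositionSubgroup (Field.absoluteGaloisGroup ℚ), ∀ P ∈ Φ, g • P = P) ∧
          ¬ (∀ g ∈ 𝔓.decompositionSubgroup (Field.absoluteGaloisGroup ℚ),
              ∀ P : WeierstrassCurve.geomTorsion W₀ ((3 : ℕ) : ℤ), g • P - P ∈ Φ))
    (hN : W₀.conductorNorm ℤ = N₀) (hK : Literature.NumberTheory.EllipticCurves.IsImaginaryQuadratic K₀)
    (hHg : Literature.NumberTheory.EllipticCurves.SatisfiesHeegnerHypothesis N₀ K₀)
    (hγ : κ₃.IsTopGenerator γ₃) (D : (W₀.baseChange K₀).LambdaAdicSelmerData κ₃ γ₃)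
    (F : HeegnerFamily N₀ W₀ K₀ κ₃ jbar₀)
    (hTT : ∀ j, ∃ m : ℤ, m ≠ 0 ∧ m • (∑ i ∈ Finset.range 3, (γ₃ ^ (3 ^ j * i)) • F.z (j + 1)) = 0) :
    heegnerModule D F = ⊥ :=
  heegnerModule_eq_bot_of_traceTorsion_of_fixedPoints_eq_bot hγ
    (CumulativeHeegnerInclusionAtThreeCellNoThreeTorsion.cell_fixedPoints_kerSubgroup_eq_bot W₀ N₀ K₀ hO6 hline hN
      hK hHg κ₃) D F hTT

end LeopoldtCellTorsion

/-! ## §4 (appended, lead g3) EVENTUAL form: torsion traces for all SUFFICIENTLY LARGE layers suffice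
(Cornut–Vatsal 2007, Lemma 4.9: «if n is sufficiently large») -/

/-- **BARRIER LEMMA, eventual torsion-trace form.** If `E(K_∞)[p^∞] = 0` and the traces `Tr_{K_{j+1}/K_j} z_{j+1}` are torsion
for all `j ≥ j₀` (the printed relation holds for CM points of sufficiently large conductor), then still `ℋ_∞(F) = ⊥`: the
universal-norm descent of §3 runs at the layers `k ≥ j₀` (it only looks upward), giving `proj_k s = 0` there, and a lower layer
`k < j₀` is recovered from `res_{k→j₀} proj_k s = 𝒩_{j₀→k} proj_{j₀} s = 0` (`resPi_proj_eq_sum_conjPi_proj`) and the injectivity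
of restriction. [cite: PerrinRiou1987BSMF, §3.4 Prop. 10 and §0 p. 402] [cite: GreenbergLNM1716, §3 Lemma 3.1] -/
theorem heegnerModule_eq_bot_of_eventually_traceTorsion_of_fixedPoints_eq_bot (hγ : κ.IsTopGenerator γ)
    (hbot : FixedPoints.addSubgroup κ.kerSubgroup ((W.baseChange K).geomPrimaryTorsion p) = ⊥)
    (D : (W.baseChange K).LambdaAdicSelmerData κ γ) (F : HeegnerFamily N W K κ jbar) (j₀ : ℕ)
    (hTT : ∀ j, j₀ ≤ j → ∃ m : ℤ, m ≠ 0 ∧ m • (∑ i ∈ Finset.range p, (γ ^ (p ^ j * i)) • F.z (j + 1)) = 0) :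
    heegnerModule D F = ⊥ := by
  have hTZK : ∀ (k : ℕ), j₀ ≤ k → ∀ (dt : (W.baseChange K).torsionH1Pi p (κ.layerSubgroup (k + 1))),
      (W.baseChange K).IsKummerFamilyOver p (κ.layerSubgroup (k + 1))
        (P := ∑ i ∈ Finset.range p, (γ ^ (p ^ k * i)) • F.z (k + 1)) (fun _ hτ ↦ smul_trace_z_eq F k hτ) dt →
        dt = 0 := by
    intro k hk dt hdt
    obtain ⟨m, hm0, hmt⟩ := hTT k hk
    exact kummerFamily_eq_zero_of_torsion_of_fixedPoints_eq_bot hbot hm0 hmt hdt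
  -- `proj_k s ∈ p^m ℋ̄_k` for all `m`, at the layers `k ≥ j₀`
  have hdiv : ∀ {s : D.S}, (∀ ℓ, D.proj ℓ s ∈ heegnerModuleLayer γ F ℓ) →
      ∀ m k : ℕ, j₀ ≤ k → ∃ y ∈ heegnerModuleLayer γ F k, D.proj k s = ((p : ℤ) ^ m) • y := by
    intro s hs m
    induction m with
    | zero => exact fun k _ ↦ ⟨D.proj k s, hs k, by rw [pow_zero, one_zsmul]⟩
    | succ m ih =>
      intro k hk
      obtain ⟨y', hy', hy'eq⟩ := ih (k + 1) (Nat.le_succ_of_le hk)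
      obtain ⟨y, hy, hyeq⟩ :=
        exists_sum_conjPi_eq_resPi_smul_of_mem_heegnerModuleLayer_of_kummerTraceZero hγ F k (hTZK k hk) hy'
      refine ⟨y, hy, ?_⟩
      have hle : κ.layerSubgroup (k + 1) ≤ κ.layerSubgroup k := κ.layerSubgroup_antitone (Nat.le_succ k)
      have hnorm := D.proj_norm k s
      rw [hy'eq, (W.baseChange K).sum_conjPi_zsmul p (κ.layerSubgroup (k + 1)) (Finset.range p)
        (fun i ↦ γ ^ (p ^ k * i)) (((p : ℤ)) ^ m) y', hyeq, ← map_zsmul, ← mul_zsmul, ← pow_succ] at hnorm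
      exact resPi_layer_injective_of_fixedPoints_eq_bot hbot hle hnorm
  -- hence `proj_k s = 0` for `k ≥ j₀`
  have hzero : ∀ {s : D.S}, (∀ ℓ, D.proj ℓ s ∈ heegnerModuleLayer γ F ℓ) → ∀ k, j₀ ≤ k → D.proj k s = 0 := by
    intro s hs k hk
    funext m
    obtain ⟨y, -, hy⟩ := hdiv hs m k hk
    calc D.proj k s m = (((p : ℤ) ^ m) • y) m := by rw [hy]
      _ = ((p : ℤ) ^ m) • y m := rfl
      _ = 0 := (W.baseChange K).pow_smul_torsionH1Over_eq_zero (κ.layerSubgroup k) p m (y m)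
  rw [heegnerModule, Submodule.span_eq_bot]
  intro s hs
  refine D.ext s fun k ↦ ?_
  rcases Nat.lt_or_ge k j₀ with hk | hk
  · -- a lower layer: restrict up to `j₀ = k + n` and use the universal-norm relation
    obtain ⟨n, rfl⟩ := Nat.exists_eq_add_of_le hk.le
    have hres := D.resPi_proj_eq_sum_conjPi_proj k n s
    rw [hzero hs (k + n) le_rfl] at hres
    simp only [map_zero, Finset.sum_const_zero] at hres
    have hinj := resPi_layer_injective_of_fixedPoints_eq_bot hbot (κ.layerSubgroup_antitone (Nat.le_add_right k n))
    exact hinj (hres.trans (map_zero _).symm)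
  · exact hzero hs k hk

/-- **Eventual torsion-trace form, `E(K)[p] = 0` version.** [cite: PerrinRiou1987BSMF, §3.4 Prop. 10] [cite: GreenbergLNM1716, §4 p. 109] -/
theorem heegnerModule_eq_bot_of_eventually_traceTorsion (hγ : κ.IsTopGenerator γ)
    (hE : ∀ P : (W.baseChange K).toAffine.Point, p • P = 0 → P = 0)
    (D : (W.baseChange K).LambdaAdicSelmerData κ γ) (F : HeegnerFamily N W K κ jbar) (j₀ : ℕ)
    (hTT : ∀ j, j₀ ≤ j → ∃ m : ℤ, m ≠ 0 ∧ m • (∑ i ∈ Finset.range p, (γ ^ (p ^ j * i)) • F.z (j + 1)) = 0) :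
    heegnerModule D F = ⊥ :=
  heegnerModule_eq_bot_of_eventually_traceTorsion_of_fixedPoints_eq_bot hγ
    ((W.baseChange K).fixedPoints_kerSubgroup_geomPrimaryTorsion_eq_bot κ hE) D F j₀ hTT

section LeopoldtCellEventual

variable {K₀ : Type} [Field K₀] [NumberField K₀] {W₀ : WeierstrassCurve ℚ} [W₀.IsElliptic] [W₀.IsGloballyMinimal]
  {N₀ : ℕ} [NeZero N₀] {κ₃ : ZpExtension K₀ 3} {γ₃ : Field.absoluteGaloisGroup K₀} {jbar₀ : AlgebraicClosure K₀ →+* ℂ}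

/-- **BARRIER LEMMA ON THE LEOPOLDT CELL, eventual torsion-trace form** (the shape in which Cornut–Vatsal's relation is printed:
good CM points of sufficiently large `3`-power conductor). [cite: PerrinRiou1987BSMF, §3.4 Prop. 10] [cite: Castella2018Erratum, Lemma 2.1] -/
theorem heegnerModule_eq_bot_on_leopoldtCell_of_eventually_traceTorsion
    (hO6 : Summit.BirchSwinnertonDyer.Rank1Residual.Additive.ClassO6 W₀ 3)
    (hline : ∃ Φ : AddSubgroup (WeierstrassCurve.geomTorsion W₀ ((3 : ℕ) : ℤ)),
        Literature.NumberTheory.EllipticCurves.Rank1Residual.IsRationalLine W₀ 3 Φ ∧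
        ∀ (v : IsDedekindDomain.HeightOneSpectrum (NumberField.RingOfIntegers ℚ)),
          ((3 : ℕ) : NumberField.RingOfIntegers ℚ) ∈ v.asIdeal → ∀ 𝔓 ∈ v.primesAbove,
          ¬ (∀ g ∈ 𝔓.decompositionSubgroup (Field.absoluteGaloisGroup ℚ), ∀ P ∈ Φ, g • P = P) ∧
          ¬ (∀ g ∈ 𝔓.decompositionSubgroup (Field.absoluteGaloisGroup ℚ),
              ∀ P : WeierstrassCurve.geomTorsion W₀ ((3 : ℕ) : ℤ), g • P - P ∈ Φ))
    (hN : W₀.conductorNorm ℤ = N₀) (hK : Literature.NumberTheory.EllipticCurves.IsImaginaryQuadratic K₀)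
    (hHg : Literature.NumberTheory.EllipticCurves.SatisfiesHeegnerHypothesis N₀ K₀)
    (hγ : κ₃.IsTopGenerator γ₃) (D : (W₀.baseChange K₀).LambdaAdicSelmerData κ₃ γ₃)
    (F : HeegnerFamily N₀ W₀ K₀ κ₃ jbar₀) (j₀ : ℕ)
    (hTT : ∀ j, j₀ ≤ j → ∃ m : ℤ, m ≠ 0 ∧ m • (∑ i ∈ Finset.range 3, (γ₃ ^ (3 ^ j * i)) • F.z (j + 1)) = 0) :
    heegnerModule D F = ⊥ :=
  heegnerModule_eq_bot_of_eventually_traceTorsion_of_fixedPoints_eq_bot hγ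
    (CumulativeHeegnerInclusionAtThreeCellNoThreeTorsion.cell_fixedPoints_kerSubgroup_eq_bot W₀ N₀ K₀ hO6 hline hN
      hK hHg κ₃) D F j₀ hTT

end LeopoldtCellEventual

end Summit.BirchSwinnertonDyer.BirchSwinnertonDyer.Theorems.CumulativeHeegnerInclusionAtThreeTraceZero

end
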